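import Summits.CriticalPhenomena.PercolationContinuityZ3.Theorems.PercNearOneGluingNoHeavyLowerTailSahiE3DimerOrStep
import Summits.CriticalPhenomena.PercolationContinuityZ3.Theorems.PercNearOneGluingNoHeavyLowerTailSahiE3ProductSections
import Summits.CriticalPhenomena.PercolationContinuityZ3.Theorems.PercNearOneGluingNoHeavyLowerTailSahiE3LroTransport
import Mathlib.Data.Fin.Tuple.Basic
import Mathlib.Algebra.BigOperators.Fin
import Mathlib.Tactic.Linarith
import Mathlib.Tactic.Ring
import HarnessLib
import HarnessLib.Audit

/-!
# `NoHeavyLowerTail` (crux stmt-CriticalPhenomena-4575), Sahi programme P4: the dimer OR-step, file 5 —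
# the certificate of `⋁ᵢ (xᵢ ∧ yᵢ) ∨ G` (DNF of width two over a certified base), all `m`

Support file (cell `prim-l12`, seat P4, generation 14; `--supports stmt-CriticalPhenomena-4575`).  No named facts, no sorries;
standard axioms; def-free.

`cert_dimer_over`: given an exactly certified base `(Q, ν_Q, G)` (hypotheses of `cert_or_step`) and, for each of `n` dimers, product
weights `w_x i, w_y i ≥ 0` on its two bits, the slot `U = {x | (∃ i, x.1 i = (true,true)) ∨ x.2 ∈ G}` of the pattern
`(Fin n → Bool × Bool) × Q` with the product weight is an up-set, the weight satisfies Harris' inequality, and `U` carries an exact flow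
certificate — by induction on `n`, one `…SahiE3DimerOrStep.cert_dimer_or_step` per dimer (the per-dimer condition `w_tf w_ft ≤ w_tt w_ff`
holds with equality for product weights), Harris lifted by `harris_layers`/`harris_prod`, transport along
`(Fin (n+1) → B) × Q ≃o B × ((Fin n → B) × Q)` (`cert_transport`), exactly as `…SahiE3LroOverBase.cert_lro_over`.
With the trivial base this is the certificate of `⋁ᵢ (xᵢ ∧ yᵢ)`; the lattice / Kahn forms (`latticeE3 ≥ 0`, Sahi's `C₃` for the first
slot `⋁ᵢ (xᵢ ∧ yᵢ)` under product measures) follow by the kernel theorem as in `…SahiE3DnfTwoSlot` / `…SahiE3DnfTwoKahn` (next file).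
HOME prim-l12-p4/FROM-prim-l12-p4-gen14-DIMER-REDUCTION.md.
-/

namespace Summit.CriticalPhenomena.PercolationContinuityZ3.Theorems.SahiE3DimerOver

open Finset SahiE3DimerOrStep SahiE3ProductSections SahiE3LroTransport SahiE3LroLayers
open scoped BigOperators

/-- Harris' inequality on the two-point chain `Bool`, for any nonnegative weight. [folklore] -/
theorem harris_bool (w : Bool → ℝ) (hw : ∀ b, 0 ≤ w b) (S S' : Finset Bool) (hS : IsUpperSet (S : Set Bool))
    (hS' : IsUpperSet (S' : Set Bool)) :
    (∑ t ∈ S, w t) * (∑ t ∈ S', w t) ≤ (∑ t, w t) * ∑ t ∈ S ∩ S', w t := by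
  have key : ∀ X : Finset Bool, IsUpperSet (X : Set Bool) → false ∈ X → X = univ := by
    intro X hX hf
    ext b
    simp only [Finset.mem_univ, iff_true]
    cases b
    · exact hf
    · exact hX (show false ≤ true from Bool.false_le _) hf
  have hwt := hw true; have hwf := hw false
  by_cases hf : false ∈ S
  · rw [key S hS hf, Finset.univ_inter]
  · by_cases hf' : false ∈ S'
    · rw [key S' hS' hf', Finset.inter_univ, mul_comm]
    · -- both avoid `false`: each is `∅` or `{true}`
      have sub : ∀ X : Finset Bool, false ∉ X → X ⊆ {true} := by
        intro X hX b hb; cases b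
        · exact absurd hb hX
        · simp
      have e1 : ∀ X : Finset Bool, X ⊆ {true} → ∑ t ∈ X, w t = if true ∈ X then w true else 0 := by
        intro X hX
        by_cases ht : true ∈ X
        · have : X = {true} := Finset.Subset.antisymm hX (by simpa using ht)
          rw [if_pos ht, this, Finset.sum_singleton]
        · have : X = ∅ := by
            ext b; cases b
            · simpa using fun h => (by simpa using hX h : False)
            · simpa using ht
          rw [if_neg ht, this, Finset.sum_empty]
      have hSS' : S ∩ S' ⊆ {true} := fun b hb => sub S hf (Finset.mem_inter.1 hb).1
      rw [e1 S (sub S hf), e1 S' (sub S' hf'), e1 (S ∩ S') hSS', Fintype.sum_bool]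
      by_cases h1 : true ∈ S <;> by_cases h2 : true ∈ S' <;>
        simp only [h1, h2, Finset.mem_inter, and_self, and_true, and_false, ↓reduceIte] <;> nlinarith

/-- `(true, true)` is the top of `Bool × Bool`. [folklore] -/
theorem eq_tt_of_tt_le (b : Bool × Bool) (h : ((true, true) : Bool × Bool) ≤ b) : b = (true, true) := by
  obtain ⟨c, d⟩ := b
  obtain ⟨h1, h2⟩ := Prod.mk_le_mk.1 h
  cases c <;> cases d <;> first | rfl | exact absurd h1 (by decide) | exact absurd h2 (by decide)

/-- **The certificate of `⋁ᵢ (xᵢ ∧ yᵢ) ∨ G` over a certified base**, by induction on the number of dimers (see the module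
docstring). [this work] -/
theorem cert_dimer_over {Q : Type*} [Fintype Q] [DecidableEq Q] [PartialOrder Q] {νQ : Q → ℝ} (hνQ : ∀ q, 0 ≤ νQ q)
    (hHQ : ∀ S S' : Finset Q, IsUpperSet (S : Set Q) → IsUpperSet (S' : Set Q) →
      (∑ t ∈ S, νQ t) * (∑ t ∈ S', νQ t) ≤ (∑ t, νQ t) * ∑ t ∈ S ∩ S', νQ t)
    (G : Finset Q) (hG : IsUpperSet (G : Set Q)) (RQ : Q → ℝ) (FlQ : Q → Q → ℝ)
    (g1 : ∀ t ∈ G, 0 ≤ RQ t) (g2 : ∀ t s, 0 ≤ FlQ t s) (g3 : ∀ t s, FlQ t s ≠ 0 → s ≤ t)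
    (g4 : ∀ t ∈ G, RQ t + ∑ s ∈ Gᶜ, FlQ t s ≤ (∑ r, νQ r) * ((∑ r, νQ r) + ∑ r ∈ Gᶜ, νQ r) * νQ t)
    (g5 : ∀ s ∈ Gᶜ, ∑ t ∈ G, FlQ t s = (∑ r, νQ r) * (∑ r ∈ G, νQ r) * νQ s)
    (g6 : ∀ S S' : Finset Q, IsUpperSet (S : Set Q) → IsUpperSet (S' : Set Q) →
      (∑ r, νQ r) * ((∑ t ∈ S, νQ t) * (∑ t ∈ S' ∩ G, νQ t) + (∑ t ∈ S', νQ t) * (∑ t ∈ S ∩ G, νQ t))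
          - (∑ r ∈ G, νQ r) * (∑ t ∈ S, νQ t) * (∑ t ∈ S', νQ t) ≤ ∑ t ∈ (S ∩ S') ∩ G, RQ t) :
    ∀ (n : ℕ) (wx wy : Fin n → Bool → ℝ) (_hwx : ∀ i b, 0 ≤ wx i b) (_hwy : ∀ i b, 0 ≤ wy i b)
      (ν : (Fin n → Bool × Bool) × Q → ℝ) (_hν : ∀ x, ν x = (∏ i, wx i (x.1 i).1 * wy i (x.1 i).2) * νQ x.2)
      (U : Finset ((Fin n → Bool × Bool) × Q))
      (_hU : ∀ x, x ∈ U ↔ ((∃ i, x.1 i = (true, true)) ∨ x.2 ∈ G)),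
    IsUpperSet (U : Set ((Fin n → Bool × Bool) × Q)) ∧
    (∀ S S' : Finset ((Fin n → Bool × Bool) × Q), IsUpperSet (S : Set ((Fin n → Bool × Bool) × Q)) →
      IsUpperSet (S' : Set ((Fin n → Bool × Bool) × Q)) →
      (∑ t ∈ S, ν t) * (∑ t ∈ S', ν t) ≤ (∑ t, ν t) * ∑ t ∈ S ∩ S', ν t) ∧
    ∃ (R : (Fin n → Bool × Bool) × Q → ℝ) (Fl : ((Fin n → Bool × Bool) × Q) → ((Fin n → Bool × Bool) × Q) → ℝ),
      (∀ t ∈ U, 0 ≤ R t) ∧ (∀ t s, 0 ≤ Fl t s) ∧ (∀ t s, Fl t s ≠ 0 → s ≤ t) ∧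
      (∀ t ∈ U, R t + ∑ s ∈ Uᶜ, Fl t s ≤ (∑ r, ν r) * ((∑ r, ν r) + ∑ r ∈ Uᶜ, ν r) * ν t) ∧
      (∀ s ∈ Uᶜ, ∑ t ∈ U, Fl t s = (∑ r, ν r) * (∑ r ∈ U, ν r) * ν s) ∧
      (∀ S S' : Finset ((Fin n → Bool × Bool) × Q), IsUpperSet (S : Set ((Fin n → Bool × Bool) × Q)) →
        IsUpperSet (S' : Set ((Fin n → Bool × Bool) × Q)) →
        (∑ r, ν r) * ((∑ t ∈ S, ν t) * (∑ t ∈ S' ∩ U, ν t) + (∑ t ∈ S', ν t) * (∑ t ∈ S ∩ U, ν t))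
          - (∑ r ∈ U, ν r) * (∑ t ∈ S, ν t) * (∑ t ∈ S', ν t) ≤ ∑ t ∈ (S ∩ S') ∩ U, R t) := by
  intro n
  induction n with
  | zero =>
    intro wx wy hwx hwy ν hν U hU
    let e : Q ≃o ((Fin 0 → Bool × Bool) × Q) :=
      { toFun := fun q => (fun i => Fin.elim0 i, q)
        invFun := fun x => x.2
        left_inv := fun q => rfl
        right_inv := fun x => by
          rcases x with ⟨f, q⟩
          simp only [Prod.mk.injEq, and_true]
          funext i; exact Fin.elim0 i
        map_rel_iff' := by
          intro q q'
          constructor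
          · intro h; exact h.2
          · intro h; exact ⟨fun i => Fin.elim0 i, h⟩ }
    have hes : ∀ x : (Fin 0 → Bool × Bool) × Q, e.symm x = x.2 := fun x => rfl
    have hνe : ∀ x : (Fin 0 → Bool × Bool) × Q, ν x = νQ (e.symm x) := fun x => by
      rw [hes, hν, Finset.univ_eq_empty, Finset.prod_empty, one_mul]
    have hUe : ∀ x : (Fin 0 → Bool × Bool) × Q, x ∈ U ↔ e.symm x ∈ G := fun x => by
      rw [hes, hU]; simp
    refine ⟨?_, harris_transport e _ hνe hHQ, cert_transport e g1 g2 g3 g4 g5 g6 _ hνe U hUe⟩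
    intro x y hxy hx
    simp only [Finset.mem_coe] at hx ⊢
    rw [hUe] at hx ⊢
    exact hG (show e.symm x ≤ e.symm y from (Prod.mk_le_mk.1 hxy).2) hx
  | succ n ih =>
    intro wx wy hwx hwy ν hν U hU
    -- the tail slot and weight on `(Fin n → Bool × Bool) × Q`
    obtain ⟨G', hG'⟩ : ∃ V : Finset ((Fin n → Bool × Bool) × Q), ∀ x, x ∈ V ↔ ((∃ i, x.1 i = (true, true)) ∨ x.2 ∈ G) :=
      ⟨univ.filter fun x => (∃ i, x.1 i = (true, true)) ∨ x.2 ∈ G, fun x => by simp⟩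
    obtain ⟨ν', hν'⟩ : ∃ f : (Fin n → Bool × Bool) × Q → ℝ,
        ∀ x, f x = (∏ i, wx i.succ (x.1 i).1 * wy i.succ (x.1 i).2) * νQ x.2 := ⟨_, fun _ => rfl⟩
    obtain ⟨hG'up, hH', R', Fl', c1, c2, c3, c4, c5, c6⟩ :=
      ih (fun i => wx i.succ) (fun i => wy i.succ) (fun i b => hwx _ _) (fun i b => hwy _ _) ν' hν' G' hG'
    have hν'0 : ∀ x, 0 ≤ ν' x := fun x => by
      rw [hν']; exact mul_nonneg (Finset.prod_nonneg fun i _ => mul_nonneg (hwx _ _) (hwy _ _)) (hνQ _)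
    -- the layered weight on `(Bool × Bool) × ((Fin n → Bool × Bool) × Q)`
    obtain ⟨ν₂, hν₂⟩ : ∃ f : (Bool × Bool) × ((Fin n → Bool × Bool) × Q) → ℝ,
        ∀ y, f y = (wx 0 y.1.1 * wy 0 y.1.2) * ν' y.2 := ⟨_, fun _ => rfl⟩
    -- Harris for the head block `Bool × Bool` and for the layered weight
    obtain ⟨νB, hνB⟩ : ∃ f : Bool × Bool → ℝ, ∀ b, f b = wx 0 b.1 * wy 0 b.2 := ⟨_, fun _ => rfl⟩
    have hνB0 : ∀ b, 0 ≤ νB b := fun b => by rw [hνB]; exact mul_nonneg (hwx _ _) (hwy _ _)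
    have hHB : ∀ S S' : Finset (Bool × Bool), IsUpperSet (S : Set (Bool × Bool)) → IsUpperSet (S' : Set (Bool × Bool)) →
        (∑ t ∈ S, νB t) * (∑ t ∈ S', νB t) ≤ (∑ t, νB t) * ∑ t ∈ S ∩ S', νB t :=
      fun S S' hS hS' => harris_layers (hwy 0) (harris_bool (wy 0) (hwy 0)) (hwx 0 true) (hwx 0 false) νB
        (fun t => by rw [hνB]) (fun t => by rw [hνB]) S S' hS hS'
    have hH₂ := harris_prod hνB0 hν'0 hHB hH' ν₂ (fun y => by rw [hν₂, hνB])
    -- `(Fin (n+1) → B) × Q ≃o B × ((Fin n → B) × Q)`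
    let e : ((Bool × Bool) × ((Fin n → Bool × Bool) × Q)) ≃o ((Fin (n + 1) → Bool × Bool) × Q) :=
      { toFun := fun y => (Fin.cons y.1 y.2.1, y.2.2)
        invFun := fun x => (x.1 0, (Fin.tail x.1, x.2))
        left_inv := fun y => by simp
        right_inv := fun x => by simp
        map_rel_iff' := by
          rintro ⟨b, f, q⟩ ⟨b', f', q'⟩
          simp only [Equiv.coe_fn_mk, Prod.mk_le_mk]
          rw [Pi.le_def, Fin.forall_iff_succ, Pi.le_def]
          simp only [Fin.cons_zero, Fin.cons_succ]
          tauto }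
    have hes : ∀ x : (Fin (n + 1) → Bool × Bool) × Q, e.symm x = (x.1 0, (Fin.tail x.1, x.2)) := fun x => rfl
    have hνe : ∀ x : (Fin (n + 1) → Bool × Bool) × Q, ν x = ν₂ (e.symm x) := fun x => by
      rw [hes, hν₂, hν, Fin.prod_univ_succ, hν']
      simp only [Fin.tail]
      ring
    -- the dimer OR-step on the head block
    obtain ⟨U₂, hU₂⟩ : ∃ V : Finset ((Bool × Bool) × ((Fin n → Bool × Bool) × Q)), ∀ y, y ∈ V ↔ (y.1 = (true, true) ∨ y.2 ∈ G') :=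
      ⟨univ.filter fun y => y.1 = (true, true) ∨ y.2 ∈ G', fun y => by simp⟩
    have hpa : (wx 0 true * wy 0 false) * (wx 0 false * wy 0 true) ≤ (wx 0 true * wy 0 true) * (wx 0 false * wy 0 false) :=
      le_of_eq (by ring)
    obtain ⟨R₂, Fl₂, d1, d2, d3, d4, d5, d6⟩ := cert_dimer_or_step hν'0 hH' G' hG'up R' Fl' c1 c2 c3 c4 c5 c6
      (mul_nonneg (hwx 0 true) (hwy 0 true)) (mul_nonneg (hwx 0 true) (hwy 0 false)) (mul_nonneg (hwx 0 false) (hwy 0 true))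
      (mul_nonneg (hwx 0 false) (hwy 0 false)) hpa ν₂ (fun s => by rw [hν₂]) (fun s => by rw [hν₂]) (fun s => by rw [hν₂])
      (fun s => by rw [hν₂]) U₂ hU₂
    have hUe : ∀ x : (Fin (n + 1) → Bool × Bool) × Q, x ∈ U ↔ e.symm x ∈ U₂ := fun x => by
      rw [hU, hes, hU₂, hG', Fin.exists_fin_succ]
      simp only [Fin.tail, or_assoc]
    refine ⟨?_, harris_transport e _ hνe hH₂, cert_transport e d1 d2 d3 d4 d5 d6 _ hνe U hUe⟩
    intro x y hxy hx
    simp only [Finset.mem_coe] at hx ⊢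
    rw [hU] at hx ⊢
    have hxy' : x.1 ≤ y.1 ∧ x.2 ≤ y.2 := Prod.mk_le_mk.1 (by simpa using hxy)
    rcases hx with ⟨i, hi⟩ | hx2
    · exact Or.inl ⟨i, eq_tt_of_tt_le _ (hi ▸ hxy'.1 i)⟩
    · exact Or.inr (hG hxy'.2 hx2)

end Summit.CriticalPhenomena.PercolationContinuityZ3.Theorems.SahiE3DimerOver
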